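import Literature.NumberTheory.GaloisRepresentations.RestrictFieldSemisimple
import Literature.RepresentationTheory.Semisimple.RelativeMaschke
import Literature.NumberTheory.Automorphic.LanglandsTetrahedral
import Literature.NumberTheory.GaloisRepresentations.WeakAbelianDirectSummandRationalRestrictProofs
import HarnessLib

/-!
# The restriction of a semisimple Galois representation to `Γ_M` is semisimple (any finite `M/F`)

Topic `Literature/NumberTheory/GaloisRepresentations`; a small *proofs* file (theorems only),
sibling of `RestrictFieldSemisimple.lean`, which proves the case `M/F` Galois
(`FramedGaloisRep.isSemisimple_restrictField`, Clifford's theorem for the normal subgroup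
`res(Γ_M) ◁ Γ_F`).  Here the Galois hypothesis is removed: for ANY finite extension `M/F` of
fields of characteristic `0` and any framed Galois representation `ρ : Γ_F → GL_n(k)` over a field
`k` of characteristic `0` with semisimple underlying representation, `ρ|_{Γ_M}` has semisimple
underlying representation — `res : Γ_M → Γ_F` is injective with image of finite index `[M:F]`
(`Literature.NumberTheory.Automorphic.isOpen_range_absGaloisRestrict_and_index`), and the
restriction of a finite-dimensional semisimple representation to a subgroup of finite index is
semisimple in characteristic `0` (Clifford for the normal core, then the relative Maschke theorem:
`Literature.RepresentationTheory.Semisimple.Representation.isSemisimpleRepresentation_restrictSubgroup_of_finiteIndex`).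

This is the tacit companion of the first reduction in the printed proof of Böckle–Hui 2025,
Thm. 1.1 (§2.7: "For any finite field extension `L/K`, the restriction `ρ_ℓ|_{Gal_L}` is also
`E`-rational … we may assume that the algebraic monodromy group `G_ℓ` is connected by replacing
`K` by some finite extension"): together with
`FramedGaloisRep.IsRationalOver.restrictField` and `FramedGaloisRep.WeaklyDivides.restrictField`
(`WeakAbelianDirectSummand{Rational,}RestrictProofs`), all three hypotheses of Thm. 1.1
(`exists_heckeCharacter_of_weaklyDivides`: `ρ` semisimple, `E`-rational, `ψ ∣_w ρ`) pass to
`ρ|_{Γ_L}`, `ψ|_{Γ_L}` for every finite `L/K` (`hypotheses_restrictField` below).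

## References

* G. Böckle, C.-Y. Hui, Math. Ann. 393 (2025), §2.7 (proof of Thm. 1.1, first reduction).
  [BockleHui2025]
* L. A. Kurdachenko, J. Otal, I. Ya. Subbotin, *Artinian Modules over Group Rings* (2007), Ch. 5,
  Cor. 5.6, Thm. 5.9. [KurdachenkoOtalSubbotin2007]
* A. H. Clifford, Ann. of Math. (2) 38 (1937), Thm. 1. [Clifford1937]
-/

noncomputable section

open scoped MatrixGroups Matrix NumberField
open Field

namespace Literature.NumberTheory.GaloisRepresentations

section Restrict

variable {F : Type*} (M : Type*) [Field F] [Field M] [Algebra F M] [FiniteDimensional F M]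
  [CharZero F] {k : Type*} [Field k] [CharZero k] [TopologicalSpace k] [IsTopologicalRing k]
  {n : ℕ}

/-- **The restriction to `Γ_M` of a semisimple Galois representation of `Γ_F` is semisimple, for
every finite extension `M/F`** (characteristic `0`, coefficients of characteristic `0`):
`res : Γ_M → Γ_F` is injective (`absGaloisRestrict_injective`) with image of index `[M:F]`
(`isOpen_range_absGaloisRestrict_and_index`), so `ρ|_{Γ_M}` is semisimple iff the restriction of
`ρ` to the finite-index subgroup `res(Γ_M)` is (`isSemisimpleRepresentation_comp_iff_of_injective`),
which it is by Clifford's theorem for the normal core and the relative Maschke theorem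
(`isSemisimpleRepresentation_restrictSubgroup_of_finiteIndex`).  The Galois case is
`FramedGaloisRep.isSemisimple_restrictField`. [folklore] -/
theorem FramedGaloisRep.isSemisimple_restrictField_of_finiteDimensional (ρ : FramedGaloisRep F k n)
    (hρ : ρ.toGaloisRep.IsSemisimple) : (ρ.restrictField M).toGaloisRep.IsSemisimple := by
  haveI : ((absGaloisRestrict F M : absoluteGaloisGroup M →* absoluteGaloisGroup F).range).FiniteIndex := by
    refine ⟨fun h0 => ?_⟩
    have h : ((absGaloisRestrict F M : absoluteGaloisGroup M →* absoluteGaloisGroup F).range).index =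
        Module.finrank F M :=
      (Automorphic.isOpen_range_absGaloisRestrict_and_index F M).2
    rw [h0] at h
    exact (Module.finrank_pos (R := F) (M := M)).ne h
  change ((ρ.restrictField M).toGaloisRep.toRepresentation).IsSemisimpleRepresentation
  rw [FramedGaloisRep.toRepresentation_restrictField,
    Representation.isSemisimpleRepresentation_comp_iff_of_injective]
  exact RepresentationTheory.Semisimple.Representation.isSemisimpleRepresentation_restrictSubgroup_of_finiteIndex
    _ _ hρ

end Restrict

section BockleHui

open Polynomial IsDedekindDomain

variable {K : Type*} [Field K] [NumberField K] (L : Type*) [Field L] [NumberField L]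
  [Algebra K L] {k : Type*} [Field k] [CharZero k] [TopologicalSpace k] [IsTopologicalRing k]
  {n : ℕ} {E : Type*} [CommRing E]

/-- **Böckle–Hui §2.7, first reduction: all hypotheses of Thm. 1.1 survive a finite base change.**
If `ρ : Γ_K →ₜ* GL_n(k)` is semisimple and `E`-rational and the character `ψ : Γ_K →ₜ* GL_1(k)`
weakly divides `ρ`, then for every finite extension `L/K` of number fields, `ρ|_{Γ_L}` is
semisimple (`isSemisimple_restrictField_of_finiteDimensional`) and `E`-rational
(`IsRationalOver.restrictField`), and `ψ|_{Γ_L}` weakly divides `ρ|_{Γ_L}`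
(`WeaklyDivides.restrictField`) — the hypotheses of `exists_heckeCharacter_of_weaklyDivides` over
`L` ("For any finite field extension `L/K`, the restriction `ρ_ℓ|_{Gal_L}` is also `E`-rational.
Since the local algebraicity of `ψ_ℓ` follows from the local algebraicity of `ψ_ℓ|_{Gal_L}`, we may
assume that the algebraic monodromy group `G_ℓ` is connected by replacing `K` by some finite
extension"). [cite: BockleHui2025, §2.7 (proof of Theorem 1.1)] -/
theorem FramedGaloisRep.hypotheses_restrictField {e : E →+* k} {ρ : FramedGaloisRep K k n}
    (hss : ρ.toGaloisRep.IsSemisimple) (hρ : ρ.IsRationalOver e) {ψ : FramedGaloisRep K k 1}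
    (hψ : ψ.WeaklyDivides ρ) :
    (ρ.restrictField L).toGaloisRep.IsSemisimple ∧ (ρ.restrictField L).IsRationalOver e ∧
      (ψ.restrictField L).WeaklyDivides (ρ.restrictField L) :=
  haveI : FiniteDimensional K L := Module.Finite.of_restrictScalars_finite ℚ K L
  ⟨ρ.isSemisimple_restrictField_of_finiteDimensional L hss, hρ.restrictField L,
    hψ.restrictField L⟩

end BockleHui

end Literature.NumberTheory.GaloisRepresentations
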